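import Summits.BirchSwinnertonDyer.BirchSwinnertonDyer.Theorems.TameQuarticSolventSolventPairLowerBoundTprimePadicForm
import HarnessLib

/-!
# Route `TameQuarticSolvent`, crux `SolventPairLowerBound` (stmt-BirchSwinnertonDyer-21391) — the HODGE SPLIT of
# the tame class (t′) at `3`: `ord₃ c₆ = 3` versus `ord₃ c₆ ≥ 5` (Kodaira `III`), `ord₃ c₆ = 6` versus
# `ord₃ c₆ ≥ 8` (Kodaira `III*`)

HONEST FRAMING. Theorems only (no definition, no named fact, no route file imported); helper
(`--supports stmt-BirchSwinnertonDyer-21391 --as helper`) of width seat bsd-wall-tqs-p1-w3 g5. It types the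
invariant that splits the (t′) leaf into the two LOCAL SHAPES AT `3` found by the seat's census
(`Cruxes/SolventPairLowerBound/TPRIME-LOCAL-SHAPE-w3g5.md`, 7 663 classes / 15 316 curves, no exception):
CASE A (`ord₃ c₆ = 3`, resp. `6`) = the good model over the quartic ring `ℤ₃[ϖ]`, `ϖ⁴ ∼ 3`, has Hasse
invariant of `ϖ`-order `2` (Hodge height `1/2`, a CANONICAL SUBGROUP of order `3`, `E[3]|G_{ℚ₃}` reducible);
CASE B (`ord₃ c₆ ≥ 5`, resp. `≥ 8`) = Hasse invariant `≡ 0 (mod 3)` (Hodge height `1`, `E[3]|G_{ℚ₃}`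
irreducible, all `3`-torsion of `ϖ`-adic valuation `1/2`). Only the valuation split is proved here; the
Galois-theoretic reading is the memo's (Newton polygon of `[3]` on the good formal group). BSD is not proved by
any of this, and nothing here closes 21391.

WHAT.
* §1 (any ring / any DVR `R` with `2 ∈ Rˣ`, `3` a uniformiser) — for a square-completed model
  `y² = x³ + A₂x² + A₄x + A₆` one has `c₆ = −64A₂³ + 288A₂A₄ − 864A₆`
  (`c₆_eq_of_a₁_a₃_eq_zero`); on the MEDIUM FORM of type `III` (`3 ∣ A₂`, `3 ∣ A₄`, `9 ∣ A₆`):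
  `27 ∣ c₆` always, `3⁵ ∣ c₆` if `9 ∣ A₂`, and `81 ∤ c₆` if `9 ∤ A₂`
  (`pow_three_dvd_c₆_of_mediumForm_III`, `pow_five_dvd_c₆_of_mediumForm_III`,
  `not_pow_four_dvd_c₆_of_mediumForm_III`); on the medium form of type `III*` (`9 ∣ A₂`, `27 ∣ A₄`,
  `3⁵ ∣ A₆`): `3⁶ ∣ c₆` always, `3⁸ ∣ c₆` if `27 ∣ A₂`, `3⁷ ∤ c₆` if `27 ∤ A₂`. So `ord c₆ ∈ {3} ∪ [5, ∞)`
  resp. `{6} ∪ [8, ∞)`, and the case is read off `ord A₂` — the coefficient whose rescaling `A₂/ϖ²` is the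
  Hasse invariant of the good model `(ϖ, 0, 0, 0) • (medium form)` modulo `3` (Deuring: for `y² = f(x)` in
  characteristic `3` the Hasse invariant is the coefficient of `x²` in `f`).
* §2 (`ℚ`-level) `tprime_padicValRat_c₆_split` — for `W/ℚ` globally minimal, elliptic, `Addv W 3`,
  `SubTprime W 3`: EITHER `ord₃ Δ = 3` and (`c₆ ≠ 0 ∧ ord₃ c₆ = 3`, or `c₆ = 0 ∨ ord₃ c₆ ≥ 5`) OR `ord₃ Δ = 9`
  and (`c₆ ≠ 0 ∧ ord₃ c₆ = 6`, or `c₆ = 0 ∨ ord₃ c₆ ≥ 8`); via the tree's `ℤ₃` medium form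
  `exists_padicInt_mediumForm_of_subTprime` and the transport `ord₃ = addVal ℤ₃` of the companion files.

References: J. H. Silverman, *AEC* III.1 (formulae for `b₂, b₄, b₆, c₆`), *ATAEC* IV.9.4; I. Papadopoulos,
J. Number Theory 44 (1993) Table III (`p = 3`); N. M. Katz, *p-adic properties of modular schemes and modular
forms* (LNM 350) §3.1 (Hasse invariant, canonical subgroup bound `p/(p+1)`).
-/

-- D-0017: single-problem summit, so `Summit.BirchSwinnertonDyer.BirchSwinnertonDyer.…` repeats a namespace BY DESIGN.
set_option linter.dupNamespace false

noncomputable section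

open IsLocalRing IsDedekindDomain
open IsDiscreteValuationRing hiding maximalIdeal
open Literature Literature.NumberTheory.DiophantineGeometry
  Literature.NumberTheory.DiophantineGeometry.TateAlgorithm
  Literature.NumberTheory.EllipticCurves Literature.NumberTheory.EllipticCurves.Rizzo
  Literature.NumberTheory.EllipticCurves.Rank1Residual
  Summit.BirchSwinnertonDyer.Rank1Residual.Additive

namespace Summit.BirchSwinnertonDyer.BirchSwinnertonDyer.Theorems.SolventPairLowerBound

/-! ## §1 `c₆` of the medium form over a ring -/

section MediumFormRing

variable {R : Type*} [CommRing R]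

/-- **`c₆` of a square-completed model.** For `y² = x³ + A₂x² + A₄x + A₆` (`a₁ = a₃ = 0`):
`c₆ = −64A₂³ + 288A₂A₄ − 864A₆` (`b₂ = 4A₂`, `b₄ = 2A₄`, `b₆ = 4A₆`, `c₆ = −b₂³ + 36b₂b₄ − 216b₆`).
Silverman *AEC* III.1. [cite: SilvermanAEC2009, III.1] -/
theorem c₆_eq_of_a₁_a₃_eq_zero (W : WeierstrassCurve R) (h₁ : W.a₁ = 0) (h₃ : W.a₃ = 0) :
    W.c₆ = -(64 * W.a₂ ^ 3) + 288 * W.a₂ * W.a₄ - 864 * W.a₆ := by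
  simp only [WeierstrassCurve.c₆, WeierstrassCurve.b₂, WeierstrassCurve.b₄, WeierstrassCurve.b₆, h₁, h₃]
  ring

/-- **Medium form of type `III`: `27 ∣ c₆`.** If `a₁ = a₃ = 0`, `3 ∣ A₂`, `3 ∣ A₄`, `9 ∣ A₆` then
`27 ∣ c₆` (`c₆ = 27·(−64s³ + 96st − 288w)` for `A₂ = 3s`, `A₄ = 3t`, `A₆ = 9w`). [folklore] -/
theorem pow_three_dvd_c₆_of_mediumForm_III (W : WeierstrassCurve R) (h₁ : W.a₁ = 0) (h₃ : W.a₃ = 0)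
    (h₂ : (3 : R) ∣ W.a₂) (h₄ : (3 : R) ∣ W.a₄) (h₆ : (3 : R) ^ 2 ∣ W.a₆) :
    (3 : R) ^ 3 ∣ W.c₆ := by
  obtain ⟨s, hs⟩ := h₂
  obtain ⟨t, ht⟩ := h₄
  obtain ⟨w, hw⟩ := h₆
  rw [c₆_eq_of_a₁_a₃_eq_zero W h₁ h₃, hs, ht, hw]
  exact ⟨-(64 * s ^ 3) + 96 * s * t - 288 * w, by ring⟩

/-- **Medium form of type `III`, case B: `3⁵ ∣ c₆`.** If `a₁ = a₃ = 0`, `9 ∣ A₂`, `3 ∣ A₄`, `9 ∣ A₆`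
then `3⁵ ∣ c₆` (`c₆ = 243·(−192s³ + 32st − 32w)` for `A₂ = 9s`, `A₄ = 3t`, `A₆ = 9w`). [folklore] -/
theorem pow_five_dvd_c₆_of_mediumForm_III (W : WeierstrassCurve R) (h₁ : W.a₁ = 0) (h₃ : W.a₃ = 0)
    (h₂ : (3 : R) ^ 2 ∣ W.a₂) (h₄ : (3 : R) ∣ W.a₄) (h₆ : (3 : R) ^ 2 ∣ W.a₆) :
    (3 : R) ^ 5 ∣ W.c₆ := by
  obtain ⟨s, hs⟩ := h₂
  obtain ⟨t, ht⟩ := h₄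
  obtain ⟨w, hw⟩ := h₆
  rw [c₆_eq_of_a₁_a₃_eq_zero W h₁ h₃, hs, ht, hw]
  exact ⟨-(192 * s ^ 3) + 32 * s * t - 32 * w, by ring⟩

/-- **Medium form of type `III*`: `3⁶ ∣ c₆`.** If `a₁ = a₃ = 0`, `9 ∣ A₂`, `27 ∣ A₄`, `3⁵ ∣ A₆` then
`3⁶ ∣ c₆` (`c₆ = 729·(−64s³ + 96st − 288w)` for `A₂ = 9s`, `A₄ = 27t`, `A₆ = 243w`). [folklore] -/
theorem pow_six_dvd_c₆_of_mediumForm_IIIstar (W : WeierstrassCurve R) (h₁ : W.a₁ = 0) (h₃ : W.a₃ = 0)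
    (h₂ : (3 : R) ^ 2 ∣ W.a₂) (h₄ : (3 : R) ^ 3 ∣ W.a₄) (h₆ : (3 : R) ^ 5 ∣ W.a₆) :
    (3 : R) ^ 6 ∣ W.c₆ := by
  obtain ⟨s, hs⟩ := h₂
  obtain ⟨t, ht⟩ := h₄
  obtain ⟨w, hw⟩ := h₆
  rw [c₆_eq_of_a₁_a₃_eq_zero W h₁ h₃, hs, ht, hw]
  exact ⟨-(64 * s ^ 3) + 96 * s * t - 288 * w, by ring⟩

/-- **Medium form of type `III*`, case B: `3⁸ ∣ c₆`.** If `a₁ = a₃ = 0`, `27 ∣ A₂`, `27 ∣ A₄`,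
`3⁵ ∣ A₆` then `3⁸ ∣ c₆`. [folklore] -/
theorem pow_eight_dvd_c₆_of_mediumForm_IIIstar (W : WeierstrassCurve R) (h₁ : W.a₁ = 0) (h₃ : W.a₃ = 0)
    (h₂ : (3 : R) ^ 3 ∣ W.a₂) (h₄ : (3 : R) ^ 3 ∣ W.a₄) (h₆ : (3 : R) ^ 5 ∣ W.a₆) :
    (3 : R) ^ 8 ∣ W.c₆ := by
  obtain ⟨s, hs⟩ := h₂
  obtain ⟨t, ht⟩ := h₄
  obtain ⟨w, hw⟩ := h₆
  rw [c₆_eq_of_a₁_a₃_eq_zero W h₁ h₃, hs, ht, hw]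
  exact ⟨-(192 * s ^ 3) + 32 * s * t - 32 * w, by ring⟩

end MediumFormRing

/-! ## §1′ The exact order in case A over a DVR with uniformiser `3` -/

section MediumFormDVR

variable {R : Type*} [CommRing R] [IsDomain R] [IsDiscreteValuationRing R]

/-- In a DVR with `2 ∈ Rˣ` and `3` a uniformiser, `3 ∣ 64·s³` forces `3 ∣ s`. [folklore] -/
theorem three_dvd_of_dvd_64_mul_cube (h2 : IsUnit (2 : R)) (h3 : Irreducible (3 : R)) {s : R}
    (h : (3 : R) ∣ 64 * s ^ 3) : (3 : R) ∣ s := by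
  have hprime : Prime (3 : R) := irreducible_iff_prime.1 h3
  rcases hprime.dvd_or_dvd h with h64 | hs3
  · have h64u : IsUnit (64 : R) := by simpa [show (2 : R) ^ 6 = 64 by norm_num] using h2.pow 6
    exact absurd (isUnit_of_dvd_unit h64 h64u) h3.not_isUnit
  · exact hprime.dvd_of_dvd_pow hs3

/-- **Medium form of type `III`, case A: `81 ∤ c₆`.** In a DVR with `2 ∈ Rˣ` and `3` a uniformiser: if
`a₁ = a₃ = 0`, `3 ∣ A₂`, `9 ∤ A₂`, `3 ∣ A₄`, `9 ∣ A₆` then `3⁴ ∤ c₆` (so `ord c₆ = 3`): from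
`c₆ = −1728s³ + 81·(32st − 96w)` a divisibility `81 ∣ c₆` would give `3 ∣ 64s³`, `3 ∣ s`. [folklore] -/
theorem not_pow_four_dvd_c₆_of_mediumForm_III (h2 : IsUnit (2 : R)) (h3 : Irreducible (3 : R))
    (W : WeierstrassCurve R) (h₁ : W.a₁ = 0) (h₃ : W.a₃ = 0) (h₂ : (3 : R) ∣ W.a₂)
    (h₂' : ¬ (3 : R) ^ 2 ∣ W.a₂) (h₄ : (3 : R) ∣ W.a₄) (h₆ : (3 : R) ^ 2 ∣ W.a₆) :
    ¬ (3 : R) ^ 4 ∣ W.c₆ := by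
  obtain ⟨s, hs⟩ := h₂
  obtain ⟨t, ht⟩ := h₄
  obtain ⟨w, hw⟩ := h₆
  have hs3 : ¬ (3 : R) ∣ s := by
    rintro ⟨s', rfl⟩
    exact h₂' ⟨s', by rw [hs]; ring⟩
  rintro ⟨m, hm⟩
  rw [c₆_eq_of_a₁_a₃_eq_zero W h₁ h₃, hs, ht, hw] at hm
  have h27 : (27 : R) * (64 * s ^ 3) = 27 * (3 * (32 * s * t - 96 * w - m)) := by
    linear_combination -hm
  have h27ne : (27 : R) ≠ 0 := by
    rw [show (27 : R) = 3 ^ 3 by norm_num]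
    exact pow_ne_zero _ h3.ne_zero
  have h := mul_left_cancel₀ h27ne h27
  exact hs3 (three_dvd_of_dvd_64_mul_cube h2 h3 ⟨_, h⟩)

/-- **Medium form of type `III*`, case A: `3⁷ ∤ c₆`.** In a DVR with `2 ∈ Rˣ` and `3` a uniformiser:
if `a₁ = a₃ = 0`, `9 ∣ A₂`, `27 ∤ A₂`, `27 ∣ A₄`, `3⁵ ∣ A₆` then `3⁷ ∤ c₆` (so `ord c₆ = 6`). [folklore] -/
theorem not_pow_seven_dvd_c₆_of_mediumForm_IIIstar (h2 : IsUnit (2 : R)) (h3 : Irreducible (3 : R))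
    (W : WeierstrassCurve R) (h₁ : W.a₁ = 0) (h₃ : W.a₃ = 0) (h₂ : (3 : R) ^ 2 ∣ W.a₂)
    (h₂' : ¬ (3 : R) ^ 3 ∣ W.a₂) (h₄ : (3 : R) ^ 3 ∣ W.a₄) (h₆ : (3 : R) ^ 5 ∣ W.a₆) :
    ¬ (3 : R) ^ 7 ∣ W.c₆ := by
  obtain ⟨s, hs⟩ := h₂
  obtain ⟨t, ht⟩ := h₄
  obtain ⟨w, hw⟩ := h₆
  have hs3 : ¬ (3 : R) ∣ s := by
    rintro ⟨s', rfl⟩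
    exact h₂' ⟨s', by rw [hs]; ring⟩
  rintro ⟨m, hm⟩
  rw [c₆_eq_of_a₁_a₃_eq_zero W h₁ h₃, hs, ht, hw] at hm
  have h729 : (729 : R) * (64 * s ^ 3) = 729 * (3 * (32 * s * t - 96 * w - m)) := by
    linear_combination -hm
  have h729ne : (729 : R) ≠ 0 := by
    rw [show (729 : R) = 3 ^ 6 by norm_num]
    exact pow_ne_zero _ h3.ne_zero
  have h := mul_left_cancel₀ h729ne h729
  exact hs3 (three_dvd_of_dvd_64_mul_cube h2 h3 ⟨_, h⟩)

end MediumFormDVR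

/-! ## §2 The Hodge split of the (t′) leaf over `ℚ` -/

section RatLevel

variable (W : WeierstrassCurve ℚ) [W.IsElliptic] [W.IsGloballyMinimal]

/-- **The Hodge split of (t′) at `3`.** For `W/ℚ` globally minimal, elliptic, additive at `3` of census
class (t′) (`Addv W 3`, `SubTprime W 3`; Kodaira `III`/`III*`, `e = 4`): EITHER `ord₃ Δ = 3` (type `III`)
and then `c₆ ≠ 0 ∧ ord₃ c₆ = 3` (case A) or `c₆ = 0 ∨ ord₃ c₆ ≥ 5` (case B), OR `ord₃ Δ = 9` (type `III*`)
and then `c₆ ≠ 0 ∧ ord₃ c₆ = 6` (case A) or `c₆ = 0 ∨ ord₃ c₆ ≥ 8` (case B). The values `ord₃ c₆ = 4`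
(resp. `7`) do not occur. Proof: §1 on the `ℤ₃` medium form `T • V` of the tree
(`exists_padicInt_mediumForm_of_subTprime`), case A/B being `9 ∤ A₂` / `9 ∣ A₂` (resp. `27`), and
`ord₃ x = addVal ℤ₃ x` transported through `V ⊗ ℚ₃ = W ⊗ ℚ₃` and the unit `T.u`. Census reading
(TPRIME-LOCAL-SHAPE-w3g5): case A = 6 605 classes (all 5 127 classes with a rational `3`-isogeny among
them), case B = 1 058 classes, of the 7 663 (t′) classes with `N < 5·10⁵`.
[cite: SilvermanATAEC1994, IV.9.4 and Table 4.1] [cite: Papadopoulos1993, Table III (p = 3)] -/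
theorem tprime_padicValRat_c₆_split (hadd : Addv W 3) (hsub : SubTprime W 3) :
    (padicValRat 3 W.Δ = 3 ∧
        ((W.c₆ ≠ 0 ∧ padicValRat 3 W.c₆ = 3) ∨ (W.c₆ = 0 ∨ 5 ≤ padicValRat 3 W.c₆))) ∨
      (padicValRat 3 W.Δ = 9 ∧
        ((W.c₆ ≠ 0 ∧ padicValRat 3 W.c₆ = 6) ∨ (W.c₆ = 0 ∨ 8 ≤ padicValRat 3 W.c₆))) := by
  classical
  obtain ⟨T, V, hVmap, hA₁, hA₃, hcases⟩ := exists_padicInt_mediumForm_of_subTprime W hadd hsub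
  have h2 : IsUnit (2 : ℤ_[3]) := isUnit_two_padicInt_three
  have h3 : Irreducible (3 : ℤ_[3]) := by simpa using PadicInt.irreducible_p (p := 3)
  set S := T • V with hS
  -- transport of valuations from `S` to `W`
  have haddu : addVal ℤ_[3] ((T.u⁻¹ : ℤ_[3]ˣ) : ℤ_[3]) = 0 :=
    addVal_def ((T.u⁻¹ : ℤ_[3]ˣ) : ℤ_[3]) T.u⁻¹ h3 0 (by rw [pow_zero, mul_one])
  have hSΔ : S.Δ = ((T.u⁻¹ : ℤ_[3]ˣ) : ℤ_[3]) ^ 12 * V.Δ := by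
    rw [hS, WeierstrassCurve.variableChange_Δ]
  have hSc₆ : S.c₆ = ((T.u⁻¹ : ℤ_[3]ˣ) : ℤ_[3]) ^ 6 * V.c₆ := by
    rw [hS, WeierstrassCurve.variableChange_c₆]
  have hvalSΔ : (addVal ℤ_[3] S.Δ).toNat = (addVal ℤ_[3] V.Δ).toNat := by
    rw [hSΔ, addVal_mul, addVal_pow, haddu]; simp
  have hvalSc₆ : (addVal ℤ_[3] S.c₆).toNat = (addVal ℤ_[3] V.c₆).toNat := by
    rw [hSc₆, addVal_mul, addVal_pow, haddu]; simp
  have hVΔ : ((V.Δ : ℤ_[3]) : ℚ_[3]) = (W.Δ : ℚ_[3]) := by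
    have h := congrArg WeierstrassCurve.Δ hVmap
    rw [WeierstrassCurve.map_Δ, WeierstrassCurve.baseChange, WeierstrassCurve.map_Δ, eq_ratCast] at h
    exact h
  have hVc₆ : ((V.c₆ : ℤ_[3]) : ℚ_[3]) = (W.c₆ : ℚ_[3]) := by
    have h := congrArg WeierstrassCurve.c₆ hVmap
    rw [WeierstrassCurve.map_c₆, WeierstrassCurve.baseChange, WeierstrassCurve.map_c₆, eq_ratCast] at h
    exact h
  have hWΔval : padicValRat 3 W.Δ = ((addVal ℤ_[3] S.Δ).toNat : ℤ) := by
    have h := congrArg Padic.valuation hVΔ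
    rw [PadicInt.valuation_coe, Padic.valuation_ratCast] at h
    rw [hvalSΔ, addVal_toNat_eq_valuation]; exact h.symm
  have hWc₆val : padicValRat 3 W.c₆ = ((addVal ℤ_[3] S.c₆).toNat : ℤ) := by
    have h := congrArg Padic.valuation hVc₆
    rw [PadicInt.valuation_coe, Padic.valuation_ratCast] at h
    rw [hvalSc₆, addVal_toNat_eq_valuation]; exact h.symm
  have hc₆0 : W.c₆ = 0 ↔ S.c₆ = 0 := by
    rw [hSc₆, mul_eq_zero, or_iff_right (pow_ne_zero _ (Units.ne_zero _)), ← PadicInt.coe_eq_zero, hVc₆,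
      Rat.cast_eq_zero]
  -- `ord c₆ < k` from `3ᵏ ∤ c₆`
  have hlt : ∀ {k : ℕ}, ¬ (3 : ℤ_[3]) ^ k ∣ S.c₆ → S.c₆ ≠ 0 ∧ (addVal ℤ_[3] S.c₆).toNat < k := by
    intro k hnd
    have hS0 : S.c₆ ≠ 0 := fun h ↦ hnd (by rw [h]; exact dvd_zero _)
    refine ⟨hS0, ?_⟩
    rw [pow_dvd_iff_le_addVal_of_irreducible h3, not_le] at hnd
    have hne : addVal ℤ_[3] S.c₆ ≠ ⊤ := by rwa [Ne, addVal_eq_top_iff]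
    rw [← ENat.coe_toNat hne] at hnd
    exact_mod_cast hnd
  rcases hcases with ⟨h₂, h₄, -, h₆, hv⟩ | ⟨h₂, h₄, -, h₆, hv⟩
  · -- Kodaira `III`
    refine Or.inl ⟨by rw [hWΔval, hv]; norm_num, ?_⟩
    by_cases h9 : (3 : ℤ_[3]) ^ 2 ∣ S.a₂
    · -- case B: `3⁵ ∣ c₆`
      refine Or.inr ?_
      by_cases hc : W.c₆ = 0
      · exact Or.inl hc
      · refine Or.inr ?_
        have hS0 : S.c₆ ≠ 0 := fun h ↦ hc (hc₆0.mpr h)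
        have h5 := le_addVal_toNat_of_pow_dvd h3 hS0
          (pow_five_dvd_c₆_of_mediumForm_III S hA₁ hA₃ h9 h₄ h₆)
        rw [hWc₆val]; exact_mod_cast h5
    · -- case A: `27 ∣ c₆`, `81 ∤ c₆`
      refine Or.inl ?_
      obtain ⟨hS0, hlt4⟩ := hlt (not_pow_four_dvd_c₆_of_mediumForm_III h2 h3 S hA₁ hA₃ h₂ h9 h₄ h₆)
      have h3le := le_addVal_toNat_of_pow_dvd h3 hS0
        (pow_three_dvd_c₆_of_mediumForm_III S hA₁ hA₃ h₂ h₄ h₆)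
      refine ⟨fun h ↦ hS0 (hc₆0.mp h), ?_⟩
      rw [hWc₆val]
      have : (addVal ℤ_[3] S.c₆).toNat = 3 := by omega
      exact_mod_cast this
  · -- Kodaira `III*`
    refine Or.inr ⟨by rw [hWΔval, hv]; norm_num, ?_⟩
    by_cases h27 : (3 : ℤ_[3]) ^ 3 ∣ S.a₂
    · -- case B: `3⁸ ∣ c₆`
      refine Or.inr ?_
      by_cases hc : W.c₆ = 0
      · exact Or.inl hc
      · refine Or.inr ?_
        have hS0 : S.c₆ ≠ 0 := fun h ↦ hc (hc₆0.mpr h)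
        have h8 := le_addVal_toNat_of_pow_dvd h3 hS0
          (pow_eight_dvd_c₆_of_mediumForm_IIIstar S hA₁ hA₃ h27 h₄ h₆)
        rw [hWc₆val]; exact_mod_cast h8
    · -- case A: `3⁶ ∣ c₆`, `3⁷ ∤ c₆`
      refine Or.inl ?_
      obtain ⟨hS0, hlt7⟩ :=
        hlt (not_pow_seven_dvd_c₆_of_mediumForm_IIIstar h2 h3 S hA₁ hA₃ h₂ h27 h₄ h₆)
      have h6le := le_addVal_toNat_of_pow_dvd h3 hS0
        (pow_six_dvd_c₆_of_mediumForm_IIIstar S hA₁ hA₃ h₂ h₄ h₆)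
      refine ⟨fun h ↦ hS0 (hc₆0.mp h), ?_⟩
      rw [hWc₆val]
      have : (addVal ℤ_[3] S.c₆).toNat = 6 := by omega
      exact_mod_cast this

end RatLevel

end Summit.BirchSwinnertonDyer.BirchSwinnertonDyer.Theorems.SolventPairLowerBound

end
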